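import Summits.BirchSwinnertonDyer.Rank1Residual.X11b.JetchevChaPairs1
import Summits.BirchSwinnertonDyer.Rank1Residual.X4.KolyvaginIndexRecordsKitOddPrime
import Summits.BirchSwinnertonDyer.Rank1Residual.Additive.IntModelTamagawaCertificateLocal
import HarnessLib

/-!
# BSD rank-≤1 residual cell, lane class X11b (`p ∥ N`, rank one): KIT for per-pair `BSD(E,p)` records from the
# Jetchev–Cha HEEGNER-INDEX certificate at a Tamagawa-OBSTRUCTED pair with ONE Tamagawa prime — the Tamagawa
# half IN THE KERNEL (one `TamLocal` certificate), `E[p]` irreducible IN THE KERNEL (one Frobenius count)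

HONEST FRAMING (cell `b2b-bsdres-*`, verbatim): prove what is provable now; shrink each hard class to its core with
data; no claim beyond stated classes; COMBINATION classes deleted from PUBLISHED theorems only, CONSTRUCTION-shaped
remainder typed; this is not "finishing BSD". X11b stays CONSTRUCTION-SHAPED; everything here is PER PAIR; no lane
verdict is changed; no named fact is introduced (debt 0: the binders `hMJ` — Miller 2011 Thm. 5.4 in the Cha case,
registry FLAGS `Miller11-Thm54-Cha-case`, `JET@p|N` — and `hGZK` are the tree's existing published named facts);
nothing is booked by this unit; Cremona's numbers are INPUTS. TOOL: two packaging theorems, no definition.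

Unit `b2b-bsdres-x11c`, GEN 33 (prover-b2b-bsdres-x11c-g33-0). The unit's gen-4 route
`X11b.bsdp_of_ainvs_of_jetchevChaCertificate` (`X11b/JetchevChaPairs1.lean` §1: Miller 2011 Thm. 5.4 under the
hypotheses of Thm. 5.2 (Cha) + GZK + a Heegner datum + ONE prime `q ∣ N` with `ord_p [E(K):ℤy_K] ≤ ord_p c_q(E)` +
`r_an ≤ 1` + `ord_p #Ш_an = 0` ⟹ Miller's `BSD(E,p)`) composed, for a LITERAL integer model and ANY prime `p ≥ 5`,
with the kernel tools the cell built since: global minimality by the bounded Kraus/Silverman criterion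
(`X11RankOne.isGloballyMinimal_of_krausCriterion_bounded`) or by the support form
(`X11b.isGloballyMinimal_of_krausCriterion_support`, no size bound), `E[p]` irreducible from ONE good prime `ℓ`
whose point count is the schema's `countPoints` (CORRECT: `X11b.natCard_point_eq_countPoints`) with
`X² − a_ℓX + ℓ` root-free mod `p` (Mazur 1978 Prop. 6.3 (1)), and — new in this kit — the TAMAGAWA HALF of the
certificate IN THE KERNEL: `c_q(W/ℚ_q) = c` from ONE stage-1 certificate `TamLocal` of the rank-2 observatory
(Tate's algorithm; split `Iₙ` ⇒ `c = n`) through team n1011's transport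
`IntModelTam.localTamagawaNumber_padic_eq_of_intModel_of_tamLocal` (`Additive/IntModelTamagawaCertificateLocal`,
NO named fact) — the shape of n1011-p03's `X11b/JetchevChaPairsNTamagawa` records `bsdp_j<label>_tam`. What is
left as binders per record: `hMJ` (FLAGGED), `hGZK`, the Heegner datum (`K` with the Heegner hypothesis for the
level `N`, `p ∤ d_K`, `p² ∤ N`, a Heegner point `P` of infinite order), `q ∣ N`, the Heegner-index line
`hv : ord_p [E(K):ℤP] ≤ w` with `w = ord_p c` a numeral, `r_an ≤ 1`, `#Ш_an = s` with `ord_p s = 0`.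

* `bsdp_prime_of_jetchevIndex_of_tamLocal` — bounded minimality form (`|Δ| < 512¹²`);
* `bsdp_prime_of_jetchevIndex_of_tamLocal_support` — support form.

Consumers: `X11b/JetchevDeepFieldRecordsNN.lean` (GEN 33: the 98 «J1» cells of the X11b rank-one Tamagawa-obstructed
lane residue at `p ≥ 5` — exactly one `q ∣ N` with `p ∣ c_q` —, two-engine Heegner-index rows in fields deeper than
the lane's `|D| ≤ 1511`). LITERAL currency (the flags ride on `hMJ`); flag-free the day director-bsd's ITEM (J∥)
«Jetchev 2008 Thm 1.4 with ‹p ∤ N› replaced by ‹p multiplicative›» lands as a theorem.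

References: R. L. Miller, LMS J. Comput. Math. 14 (2011) Thm. 5.4, Thm. 5.2, Def. 1.1 [Miller2011LMS]; D. Jetchev,
Compos. Math. 144 (2008) Thm. 1.1 [Jetchev2008]; B. Mazur, Invent. Math. 44 (1978) Prop. 6.3 (1) [Mazur1978];
J. Tate, LNM 476 (1975) §7 [Tate1975]; J. H. Silverman, GTM 151 (1994) IV.9.4 [Silverman1994]; J. H. Silverman,
*AEC* (2009) VII.1 Rem. 1.1, VII.6 Ex. 7.6 [SilvermanAEC2009]; A. Kraus, Acta Arith. 54 (1989) Prop. 1–2 [Kraus1989].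
-/

set_option autoImplicit false

noncomputable section

open scoped Classical

open WeierstrassCurve Literature.NumberTheory.EllipticCurves
  Literature.NumberTheory.EllipticCurves.Rank1Residual
  Literature.NumberTheory.EllipticCurves.Rank1Residual.Typed
  Literature.NumberTheory.EllipticCurves.Miller2011
  Literature.NumberTheory.EllipticCurves.Rank1Residual.X11RankOneCertificates
  Summit.BirchSwinnertonDyer.BirchSwinnertonDyer.Rank1Residual.IntModel
  Summit.BirchSwinnertonDyer.BirchSwinnertonDyer.Rank1Residual.X11RankOne
  Summit.BirchSwinnertonDyer.BirchSwinnertonDyer.Rank2Observatory.Tam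
  Summit.BirchSwinnertonDyer.Rank1Residual.Additive

namespace Summit.BirchSwinnertonDyer.Rank1Residual.X11b

/-- **`BSD(E,p)` at a prime `p ≥ 5` for a literal integer model from the Jetchev–Cha HEEGNER-INDEX certificate at a
pair with ONE Tamagawa prime `q` — Tamagawa half and irreducibility in the kernel; bounded minimality form.**
Inputs: (kernel, `decide` goals for a record) `Δ ≠ 0`, `|Δ| < 512¹²` and the bounded Kraus disjunction below `512`
(⇒ `IsElliptic`, `IsGloballyMinimal`); `p ∣ Δ`, `p ∤ c₄` (multiplicative at `p`); one prime `ℓ ∉ {2, p}`, `ℓ ∤ Δ`,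
with `countPoints = n` and `X² − (ℓ + 1 − n)X + ℓ` root-free mod `p` (⇒ `E[p]` irreducible); one `TamLocal`
certificate `T` at the prime `q` with `T.check = true` and singleton value set `[c]` (⇒ `c_q(W/ℚ_q) = c`), and
`w = ord_p c`; (binders) `hMJ` (Miller 2011 Thm. 5.4, Cha case; FLAGGED), `hGZK`, the Heegner datum `K`, `N`, `P`
with `p ∤ d_K`, `p² ∤ N`, `q ∣ N`, the index line `ord_p [E(K):ℤP] ≤ w`, `r_an ≤ 1`, `#Ш_an = s` with `ord_p s = 0`.
Output: Miller's `BSD(E,p)` through `bsdp_of_ainvs_of_jetchevChaCertificate`. Per pair; no class statement.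
[cite: Miller2011LMS, Thm. 5.4 (arXiv:1010.2431 p. 11) and Def. 1.1] [cite: Jetchev2008, Thm. 1.1]
[cite: Mazur1978, §6 Prop. 6.3 (1) (p. 153)] [cite: Silverman1994, IV.9.4] [cite: SilvermanAEC2009, VII.1 Remark 1.1 and VII.6 Ex. 7.6] -/
theorem bsdp_prime_of_jetchevIndex_of_tamLocal (p : ℕ) (hp : p.Prime) (hp5 : 5 ≤ p) (a1 a2 a3 a4 a6 : ℤ)
    (h0 : discOf [a1, a2, a3, a4, a6] ≠ 0) (h512 : (discOf [a1, a2, a3, a4, a6]).natAbs < 512 ^ 12)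
    (hKraus : ∀ q < 512, q < 2 ∨ ¬ q ^ 12 ∣ (discOf [a1, a2, a3, a4, a6]).natAbs ∨
      ¬ q ^ 4 ∣ (c4Of [a1, a2, a3, a4, a6]).natAbs ∨
      (q = 2 ∧ ¬ (2 : ℤ) ^ 8 ∣ c4Of [a1, a2, a3, a4, a6] ∧ (2 : ℤ) ^ 7 ∣ c6Of [a1, a2, a3, a4, a6]) ∨
      (q = 2 ∧ ¬ (2 : ℤ) ^ 24 ∣ discOf [a1, a2, a3, a4, a6] ∧ (512 : ℤ) ∣ c6Of [a1, a2, a3, a4, a6] ∧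
        (4 : ℤ) ∣ c6Of [a1, a2, a3, a4, a6] / 512 - 3) ∨
      (q = 3 ∧ (3 : ℤ) ^ 8 ∣ c6Of [a1, a2, a3, a4, a6] ∧ ¬ (3 : ℤ) ^ 9 ∣ c6Of [a1, a2, a3, a4, a6]))
    (hpΔ : (p : ℤ) ∣ discOf [a1, a2, a3, a4, a6]) (hpc4 : ¬ (p : ℤ) ∣ c4Of [a1, a2, a3, a4, a6])
    (ℓ : ℕ) (hℓ : ℓ.Prime) (h2ℓ : ℓ ≠ 2) (hne : ℓ ≠ p)
    (hΔℓ : ¬ (ℓ : ℤ) ∣ (⟨a1, a2, a3, a4, a6⟩ : WeierstrassCurve ℤ).Δ)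
    {n : ℕ} (hc : countPoints [a1, a2, a3, a4, a6] ℓ = n)
    (hnoroot : ∀ t : ℕ, t < p → ¬ (p : ℤ) ∣ (t : ℤ) ^ 2 - ((ℓ : ℤ) + 1 - n) * t + ℓ)
    (q : ℕ) (hq : q.Prime) {T : TamLocal} (hTq : T.p = q)
    (hTc : T.check (⟨a1, a2, a3, a4, a6⟩ : WeierstrassCurve ℤ) = true) {c : ℕ} (hT1 : T.vals = [c])
    {w : ℕ} (hw : padicValNat p c = w)
    (hMJ : thm54_cha_padicValNat_shaOrder_add_tamagawa_le)
    (hGZK : rank_eq_analyticRank_of_analyticRank_le_one)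
    (W : WeierstrassCurve ℚ) (hW : W = ⟨a1, a2, a3, a4, a6⟩)
    {N : ℕ} [NeZero N] {K : Type} [Field K] [NumberField K] (hK : IsImaginaryQuadratic K)
    (hH : SatisfiesHeegnerHypothesis N K) {P : (W.baseChange K).toAffine.Point}
    (hP : IsHeegnerPoint N W K P) (hnt : ¬ IsOfFinAddOrder P)
    (hpD : ¬ (p : ℤ) ∣ NumberField.discr K) (hpN : ¬ p ^ 2 ∣ N) (hqN : q ∣ N)
    (hv : padicValNat p (AddSubgroup.zmultiples P).index ≤ w)
    (hr : W.analyticRank ≤ 1) {s : ℚ} (hs : shaAn W = (s : ℂ)) (hvs : padicValRat p s = 0) :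
    BSDp W p := by
  subst hW
  haveI hE : (⟨a1, a2, a3, a4, a6⟩ : WeierstrassCurve ℚ).IsElliptic :=
    isElliptic_of_discOf_ne_zero a1 a2 a3 a4 a6 h0
  haveI hM : (⟨a1, a2, a3, a4, a6⟩ : WeierstrassCurve ℚ).IsGloballyMinimal :=
    isGloballyMinimal_of_krausCriterion_bounded a1 a2 a3 a4 a6 h0 h512 hKraus
  haveI : Fact (Nat.Prime p) := ⟨hp⟩
  haveI := Fact.mk hℓ; haveI := Fact.mk hq
  have hp2 : p ≠ 2 := by omega
  have hI0 : integralModelInt (⟨a1, a2, a3, a4, a6⟩ : WeierstrassCurve ℚ) = ⟨a1, a2, a3, a4, a6⟩ :=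
    integralModelInt_eq_of_map_eq _ (map_mk_int a1 a2 a3 a4 a6)
  have hn : Nat.card (((⟨a1, a2, a3, a4, a6⟩ : WeierstrassCurve ℤ).map
      (Int.castRingHom (ZMod ℓ))).toAffine.Point) = n := by
    exact_mod_cast (natCard_point_eq_countPoints a1 a2 a3 a4 a6 ℓ h2ℓ hΔℓ).trans hc
  have hΔℓ' : ¬ (ℓ : ℤ) ∣ discOf [a1, a2, a3, a4, a6] := by
    rw [← intCurve_Δ a1 a2 a3 a4 a6]; exact hΔℓ
  have hcq : ((⟨a1, a2, a3, a4, a6⟩ : WeierstrassCurve ℚ).baseChange ℚ_[q]).localTamagawaNumber ℤ_[q] = c :=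
    IntModelTam.localTamagawaNumber_padic_eq_of_intModel_of_tamLocal hI0 q hTq hTc hT1
  exact bsdp_of_ainvs_of_jetchevChaCertificate hMJ hGZK a1 a2 a3 a4 a6 hI0 p ℓ n hp2 hpΔ hpc4 hne hΔℓ'
    hn hnoroot hK hH hP hnt hpD hpN q hqN (by rw [hcq, hw]; exact hv) hr hs hvs

/-- **`BSD(E,p)` at a prime `p ≥ 5` for a literal integer model from the Jetchev–Cha HEEGNER-INDEX certificate at a
pair with ONE Tamagawa prime — SUPPORT form.** As `bsdp_prime_of_jetchevIndex_of_tamLocal`, with global minimality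
from the support `bad` of `Δ` (`|Δ| = ∏ q^{v_q Δ}`, each listed `q` prime) and the per-prime Kraus/Silverman test
(`X11b.isGloballyMinimal_of_krausCriterion_support`; no size bound on `Δ`). Per pair; no class statement.
[cite: Miller2011LMS, Thm. 5.4 (arXiv:1010.2431 p. 11) and Def. 1.1] [cite: Jetchev2008, Thm. 1.1]
[cite: Mazur1978, §6 Prop. 6.3 (1) (p. 153)] [cite: Kraus1989, Prop. 1 and Prop. 2]
[cite: Silverman1994, IV.9.4] [cite: SilvermanAEC2009, VII.1 Remark 1.1, VII.6 Ex. 7.6 and VIII.8] -/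
theorem bsdp_prime_of_jetchevIndex_of_tamLocal_support (p : ℕ) (hp : p.Prime) (hp5 : 5 ≤ p)
    (a1 a2 a3 a4 a6 : ℤ)
    (h0 : discOf [a1, a2, a3, a4, a6] ≠ 0) (bad : List (ℕ × ℕ × ℕ)) (hprime : ∀ t ∈ bad, t.1.Prime)
    (hsupp : (discOf [a1, a2, a3, a4, a6]).natAbs = (bad.map fun t => t.1 ^ t.2.2).prod)
    (hmin : ∀ t ∈ bad,
      (¬ (t.1 : ℤ) ^ 12 ∣ discOf [a1, a2, a3, a4, a6] ∨ ¬ (t.1 : ℤ) ^ 4 ∣ c4Of [a1, a2, a3, a4, a6]) ∨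
      (t.1 = 2 ∧ (16 : ℤ) ∣ c4Of [a1, a2, a3, a4, a6] ∧ (64 : ℤ) ∣ c6Of [a1, a2, a3, a4, a6] ∧
        ¬ (((16 : ℤ) ∣ c4Of [a1, a2, a3, a4, a6] / 16 ∧
            ((32 : ℤ) ∣ c6Of [a1, a2, a3, a4, a6] / 64 ∨ (32 : ℤ) ∣ c6Of [a1, a2, a3, a4, a6] / 64 - 8)) ∨
          (4 : ℤ) ∣ c6Of [a1, a2, a3, a4, a6] / 64 + 1)) ∨
      (t.1 = 3 ∧ (3 : ℤ) ^ 8 ∣ c6Of [a1, a2, a3, a4, a6] ∧ ¬ (3 : ℤ) ^ 9 ∣ c6Of [a1, a2, a3, a4, a6]))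
    (hpΔ : (p : ℤ) ∣ discOf [a1, a2, a3, a4, a6]) (hpc4 : ¬ (p : ℤ) ∣ c4Of [a1, a2, a3, a4, a6])
    (ℓ : ℕ) (hℓ : ℓ.Prime) (h2ℓ : ℓ ≠ 2) (hne : ℓ ≠ p)
    (hΔℓ : ¬ (ℓ : ℤ) ∣ (⟨a1, a2, a3, a4, a6⟩ : WeierstrassCurve ℤ).Δ)
    {n : ℕ} (hc : countPoints [a1, a2, a3, a4, a6] ℓ = n)
    (hnoroot : ∀ t : ℕ, t < p → ¬ (p : ℤ) ∣ (t : ℤ) ^ 2 - ((ℓ : ℤ) + 1 - n) * t + ℓ)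
    (q : ℕ) (hq : q.Prime) {T : TamLocal} (hTq : T.p = q)
    (hTc : T.check (⟨a1, a2, a3, a4, a6⟩ : WeierstrassCurve ℤ) = true) {c : ℕ} (hT1 : T.vals = [c])
    {w : ℕ} (hw : padicValNat p c = w)
    (hMJ : thm54_cha_padicValNat_shaOrder_add_tamagawa_le)
    (hGZK : rank_eq_analyticRank_of_analyticRank_le_one)
    (W : WeierstrassCurve ℚ) (hW : W = ⟨a1, a2, a3, a4, a6⟩)
    {N : ℕ} [NeZero N] {K : Type} [Field K] [NumberField K] (hK : IsImaginaryQuadratic K)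
    (hH : SatisfiesHeegnerHypothesis N K) {P : (W.baseChange K).toAffine.Point}
    (hP : IsHeegnerPoint N W K P) (hnt : ¬ IsOfFinAddOrder P)
    (hpD : ¬ (p : ℤ) ∣ NumberField.discr K) (hpN : ¬ p ^ 2 ∣ N) (hqN : q ∣ N)
    (hv : padicValNat p (AddSubgroup.zmultiples P).index ≤ w)
    (hr : W.analyticRank ≤ 1) {s : ℚ} (hs : shaAn W = (s : ℂ)) (hvs : padicValRat p s = 0) :
    BSDp W p := by
  subst hW
  haveI hE : (⟨a1, a2, a3, a4, a6⟩ : WeierstrassCurve ℚ).IsElliptic :=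
    isElliptic_of_discOf_ne_zero a1 a2 a3 a4 a6 h0
  haveI hM : (⟨a1, a2, a3, a4, a6⟩ : WeierstrassCurve ℚ).IsGloballyMinimal :=
    isGloballyMinimal_of_krausCriterion_support a1 a2 a3 a4 a6 bad hprime hsupp hmin
  haveI : Fact (Nat.Prime p) := ⟨hp⟩
  haveI := Fact.mk hℓ; haveI := Fact.mk hq
  have hp2 : p ≠ 2 := by omega
  have hI0 : integralModelInt (⟨a1, a2, a3, a4, a6⟩ : WeierstrassCurve ℚ) = ⟨a1, a2, a3, a4, a6⟩ :=
    integralModelInt_eq_of_map_eq _ (map_mk_int a1 a2 a3 a4 a6)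
  have hn : Nat.card (((⟨a1, a2, a3, a4, a6⟩ : WeierstrassCurve ℤ).map
      (Int.castRingHom (ZMod ℓ))).toAffine.Point) = n := by
    exact_mod_cast (natCard_point_eq_countPoints a1 a2 a3 a4 a6 ℓ h2ℓ hΔℓ).trans hc
  have hΔℓ' : ¬ (ℓ : ℤ) ∣ discOf [a1, a2, a3, a4, a6] := by
    rw [← intCurve_Δ a1 a2 a3 a4 a6]; exact hΔℓ
  have hcq : ((⟨a1, a2, a3, a4, a6⟩ : WeierstrassCurve ℚ).baseChange ℚ_[q]).localTamagawaNumber ℤ_[q] = c :=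
    IntModelTam.localTamagawaNumber_padic_eq_of_intModel_of_tamLocal hI0 q hTq hTc hT1
  exact bsdp_of_ainvs_of_jetchevChaCertificate hMJ hGZK a1 a2 a3 a4 a6 hI0 p ℓ n hp2 hpΔ hpc4 hne hΔℓ'
    hn hnoroot hK hH hP hnt hpD hpN q hqN (by rw [hcq, hw]; exact hv) hr hs hvs

end Summit.BirchSwinnertonDyer.Rank1Residual.X11b

end
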